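import Summits.Ventures.GridStability.Models.StructurePreservingDefinite

/-!
# GridStability/Models/StructurePreservingInvariant — the momentum first integral of the
# structure-preserving model and isolation of the equilibrium on its level sets

LADDER-GRIDFUSION rung G3, seat gridfusion-model-2; MODEL-VALIDITY row MV-3 (and MV-ω). Companion
of `StructurePreserving.lean` (model, `IsSolution.coi_balance`), `StructurePreservingEnergy.lean`
(sign / quadratic sandwich of the printed energy) and `StructurePreservingDefinite.lean` (zero set
of the energy = rotation orbit of the equilibrium for a preconnected coupling graph).

WHY. Bergen–Hill's topological Lyapunov function `V` [cite: Padiyar2013, §3.2 eq (3.11)];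
[cite: BergenHill1981] is invariant under a common rotation of all bus angles, so in ABSOLUTE bus
angles its zero set is a line and no sublevel set is compact — the reason print passes to `(n − 1)`
internodal angles [cite: Padiyar2013, §3.2 eq (3.6)]. This file records the alternative that needs
no change of coordinates: summing the model equations (3.2) over all buses of the lossless network
[cite: Padiyar2013, §3.2 Remark 1, eq (3.15)] shows that the affine «angular momentum» functional
`L(δ, δ̇) = Σ_{i ∈ gen} Mᵢ δ̇ᵢ + Σᵢ Dᵢ δᵢ` moves at the constant rate `Σᵢ P⁰ᵢ` — hence is a FIRST
INTEGRAL in the frequency-shifted frame (`Σ P̄ᵢ = 0`, eqs (3.3)–(3.5)) — and the rotation direction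
is transversal to its level sets (`Σ Dᵢ > 0`). Consequently, on a level set of `L` and inside the
window of `StructurePreservingDefinite`, `V = 0` happens at exactly ONE state: the equilibrium is
isolated there, which is the hypothesis a sublevel / LaSalle argument (tree:
`Literature/Analysis/ODE/LyapunovSublevelInvariance`, `…/LyapunovBarbashinKrasovskii`, constraint set
= a level set of `L`) needs. The ODE-level assembly is the Lyapunov seat's (PARTITION §0 row
Lyapunov/); this file supplies the model-side ingredients only.

## Contents
* `Params.momentum` and `hasDerivAt_momentum`: `dL/dt = Σᵢ P⁰ᵢ` along every `IsSolution`;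
* `momentum_eq_of_isSolution`: `L(t) = L(0) + t·Σᵢ P⁰ᵢ`; `momentum_const_of_shifted`: constant in
  the shifted frame;
* `momentum_shift`: a common rotation by `c` changes `L` by `c·Σᵢ Dᵢ`; `sum_D_pos`;
* `eq_of_energy_eq_zero_of_momentum_eq`: on `{L = L(δ₀, 0)}` and the window, `V(δ, ω) = 0` forces
  `δ = δ₀` and zero generator frequencies — isolation of the equilibrium WITHOUT quotienting;
* `state_bound_of_energy_le` (with `half_M_mul_sq_le_kinetic`, `branch_sq_le_quadraticGap`,
  `abs_sub_le_length_mul`, `abs_sub_le_card_mul`): on `{L = L(δ₀, 0)}` and the window,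
  `V ≤ c` confines every generator frequency (`|ωᵢ| ≤ √(2c/Mᵢ)`) and every bus angle
  (`|δᵢ − δ₀ᵢ| ≤ (Σ_gen Mⱼ√(2c/Mⱼ))/ΣDⱼ + n·√(4c/(g(θ)β))`, `β` a lower bound of the couplings on
  the edges of the preconnected coupling graph, `g(θ)` the strict sector gain of
  [cite: VuTuritsyn2017, §IV-A]) — the boundedness half of «small sublevel sets are compact»;
* `branch_abs_lt_of_energy_le` (appended): for `c < g(θ)·β·(π/2 − θ)²/4`, `V ≤ c` forces every
  coupled branch STRICTLY inside the window (`|δᵢ − δⱼ| < π/2`) — the sublevel set avoids the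
  window's boundary.

MODELLED (three columns): mathematics about the typed model MV-3; no certificate; no grid claim.
-/

noncomputable section

open Finset Real

namespace Summit.Ventures.GridStability.Models.StructurePreserving.Params

variable {n : ℕ}

/-- The «angular momentum» functional of the structure-preserving model,
`L(δ, v) = Σ_{i ∈ gen} Mᵢ vᵢ + Σᵢ Dᵢ δᵢ` (generator momenta plus the D-weighted bus angles; the
load buses enter through their frequency coefficients) — the quantity whose balance is
[cite: Padiyar2013, §3.2 eq (3.15)]. -/
def momentum (p : Params n) (δ v : Fin n → ℝ) : ℝ :=
  ∑ i ∈ p.gen, p.M i * v i + ∑ i, p.D i * δ i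

/-- **Momentum balance**: along every solution of the structure-preserving model with well-formed
(lossless, symmetric) data, `d/dt L(δ(t), δ̇(t)) = Σᵢ P⁰ᵢ` — the integrated form of the
centre-of-inertia balance `Σ_gen Mᵢ δ̈ᵢ = Σᵢ P⁰ᵢ − Σᵢ Dᵢ δ̇ᵢ` (`IsSolution.coi_balance`,
[cite: Padiyar2013, §3.2 Remark 1, eq (3.15)]). -/
theorem hasDerivAt_momentum {p : Params n} (hp : p.WellFormed) {δ : ℝ → Fin n → ℝ}
    (h : p.IsSolution δ) (t : ℝ) :
    HasDerivAt (fun s => p.momentum (δ s) (fun i => deriv (fun u => δ u i) s)) (∑ i, p.P0 i) t := by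
  have h1 : HasDerivAt (fun s => ∑ i ∈ p.gen, p.M i * deriv (fun u => δ u i) s)
      (∑ i ∈ p.gen, p.M i * deriv (deriv fun u => δ u i) t) t := by
    refine HasDerivAt.fun_sum fun i hi => ?_
    exact ((h.differentiable_deriv i hi) t).hasDerivAt.const_mul (p.M i)
  have h2 : HasDerivAt (fun s => ∑ i, p.D i * δ s i) (∑ i, p.D i * deriv (fun u => δ u i) t) t := by
    refine HasDerivAt.fun_sum fun i _ => ?_
    exact ((h.differentiable i) t).hasDerivAt.const_mul (p.D i)
  have h12 := h1.add h2
  have hbal := h.coi_balance hp t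
  have hval : ∑ i ∈ p.gen, p.M i * deriv (deriv fun u => δ u i) t
      + ∑ i, p.D i * deriv (fun u => δ u i) t = ∑ i, p.P0 i := by
    rw [hbal]; ring
  rw [hval] at h12
  exact h12

/-- **`L` is affine in time**: `L(δ(t), δ̇(t)) = L(δ(0), δ̇(0)) + t·Σᵢ P⁰ᵢ` along every solution. -/
theorem momentum_eq_of_isSolution {p : Params n} (hp : p.WellFormed) {δ : ℝ → Fin n → ℝ}
    (h : p.IsSolution δ) (t : ℝ) :
    p.momentum (δ t) (fun i => deriv (fun u => δ u i) t)
      = p.momentum (δ 0) (fun i => deriv (fun u => δ u i) 0) + t * ∑ i, p.P0 i := by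
  -- the difference with the affine function has zero derivative everywhere
  have hd : ∀ s, HasDerivAt (fun s => p.momentum (δ s) (fun i => deriv (fun u => δ u i) s)
      - s * ∑ i, p.P0 i) 0 s := by
    intro s
    have h1 := hasDerivAt_momentum hp h s
    have h2 : HasDerivAt (fun s : ℝ => s * ∑ i, p.P0 i) (∑ i, p.P0 i) s := by
      simpa using (hasDerivAt_id s).mul_const (∑ i, p.P0 i)
    have := h1.fun_sub h2
    simpa using this
  have hconst := is_const_of_deriv_eq_zero (fun s => (hd s).differentiableAt)
    (fun s => (hd s).deriv) t 0
  simp only [zero_mul, sub_zero] at hconst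
  linarith

/-- **First integral in the frequency-shifted frame**: along every solution of the SHIFTED model
(`P⁰ ↦ P̄`, `Σᵢ P̄ᵢ = 0`, [cite: Padiyar2013, §3.2 eqs (3.3)–(3.5)]) the momentum functional is
constant. -/
theorem momentum_const_of_shifted {p : Params n} (hp : p.WellFormed) (hD : ∑ i, p.D i ≠ 0)
    {δ : ℝ → Fin n → ℝ} (h : p.shifted.IsSolution δ) (t : ℝ) :
    p.momentum (δ t) (fun i => deriv (fun u => δ u i) t)
      = p.momentum (δ 0) (fun i => deriv (fun u => δ u i) 0) := by
  have hp' : p.shifted.WellFormed := ⟨hp.M_pos, hp.M_eq_zero, hp.D_pos, hp.b_symm⟩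
  have h0 : ∑ i, p.shifted.P0 i = 0 := by
    simpa only [shifted_P0] using p.sum_Pbar_eq_zero hD
  have hm := momentum_eq_of_isSolution hp' h t
  have hmom : ∀ δ' v : Fin n → ℝ, p.shifted.momentum δ' v = p.momentum δ' v := fun _ _ => rfl
  rw [hmom, hmom, h0, mul_zero, add_zero] at hm
  exact hm

/-- A common rotation of the bus angles by `c` shifts the momentum by `c · Σᵢ Dᵢ` — the rotation
direction is transversal to the level sets of `L`. -/
theorem momentum_shift (p : Params n) (δ v : Fin n → ℝ) (c : ℝ) :
    p.momentum (fun i => δ i + c) v = p.momentum δ v + c * ∑ i, p.D i := by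
  unfold momentum
  rw [Finset.mul_sum, add_assoc, ← Finset.sum_add_distrib]
  congr 1
  exact Finset.sum_congr rfl fun i _ => by ring

/-- With `Dᵢ > 0` at every bus and at least one bus, `Σᵢ Dᵢ > 0`. -/
theorem sum_D_pos {p : Params n} (hp : p.WellFormed) (hn : n ≠ 0) : 0 < ∑ i, p.D i := by
  obtain ⟨k, hk⟩ := Nat.exists_eq_succ_of_ne_zero hn
  subst hk
  exact Finset.sum_pos (fun i _ => hp.D_pos i) ⟨0, mem_univ 0⟩

/-- **Isolation of the equilibrium on a momentum level set** (well-formed data with susceptive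
couplings `bᵢⱼ ≥ 0`, preconnected coupling graph, `n ≠ 0`, the window `|δ₀ᵢ − δ₀ⱼ| ≤ θ < π/2`,
`|δᵢ − δⱼ| ≤ π/2` on coupled pairs): if `V(δ, ω) = 0` and `L(δ, ω) = L(δ₀, 0)`, then `δ = δ₀` and
every generator frequency vanishes. Combines `energy_eq_zero_iff` (zero set = rotation orbit) with
`momentum_shift` (rotations move `L`). This is the «isolated minimum» hypothesis of a Lyapunov /
LaSalle argument for MODEL MV-3 on the invariant level set of the first integral `L`
(`momentum_const_of_shifted`), obtained without passing to internodal coordinates. -/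
theorem eq_of_energy_eq_zero_of_momentum_eq {p : Params n} (hp : p.WellFormed) (hn : n ≠ 0)
    (hconn : p.couplingGraph.Preconnected) (hb : ∀ i j, 0 ≤ p.b i j)
    {δ₀ δ : Fin n → ℝ} {θ : ℝ} (hθ0 : 0 ≤ θ) (hθ : θ < π / 2)
    (h0 : ∀ i j, p.b i j ≠ 0 → |δ₀ i - δ₀ j| ≤ θ)
    (hP : ∀ i j, p.b i j ≠ 0 → |δ i - δ j| ≤ π / 2) {ω : Fin n → ℝ}
    (hV : p.energy δ₀ δ ω = 0) (hL : p.momentum δ ω = p.momentum δ₀ 0) :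
    δ = δ₀ ∧ ∀ i ∈ p.gen, ω i = 0 := by
  obtain ⟨⟨c, hc⟩, hω⟩ := (energy_eq_zero_iff hp hn hconn hb hθ0 hθ h0 hP ω).mp hV
  refine ⟨?_, hω⟩
  -- L(δ₀ + c, ω) = L(δ₀, ω) + cΣD and the generator part of L vanishes with ω on gen
  have hδ : δ = fun i => δ₀ i + c := funext hc
  have hgen : ∑ i ∈ p.gen, p.M i * ω i = 0 :=
    Finset.sum_eq_zero fun i hi => by rw [hω i hi, mul_zero]
  have hL' : p.momentum δ ω = p.momentum δ₀ 0 + c * ∑ i, p.D i := by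
    rw [hδ, momentum_shift]
    unfold momentum
    rw [hgen]
    simp
  have hcD : c * ∑ i, p.D i = 0 := by linarith
  have hc0 : c = 0 := by
    rcases mul_eq_zero.mp hcD with h | h
    · exact h
    · exact absurd h (sum_D_pos hp hn).ne'
  rw [hδ]
  funext i
  rw [hc0, add_zero]

/-! ## Boundedness of the states with small energy on a momentum level set (compactness
precursor; appended by model-2 g2) -/

/-- A single generator's kinetic term is bounded by the total: `½ Mᵢ ωᵢ² ≤ kinetic` (`Mⱼ ≥ 0`). -/
theorem half_M_mul_sq_le_kinetic (p : Params n) (hM : ∀ i ∈ p.gen, 0 ≤ p.M i) (ω : Fin n → ℝ)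
    {i : Fin n} (hi : i ∈ p.gen) : (1 / 2) * (p.M i * ω i ^ 2) ≤ p.kinetic ω := by
  unfold kinetic
  refine mul_le_mul_of_nonneg_left ?_ (by norm_num)
  exact Finset.single_le_sum (f := fun j => p.M j * ω j ^ 2)
    (fun j hj => mul_nonneg (hM j hj) (sq_nonneg _)) hi

/-- A single coupled branch's quadratic term is bounded by the comparison form:
`bᵢⱼ (Δσᵢⱼ)²/4 ≤ Q = ½ Σ Σ b (Δσ)²/2` (`b ≥ 0`). -/
theorem branch_sq_le_quadraticGap (p : Params n) (hb : ∀ i j, 0 ≤ p.b i j) (δ₀ δ : Fin n → ℝ)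
    (i j : Fin n) :
    (1 / 2) * (p.b i j * (((δ i - δ j) - (δ₀ i - δ₀ j)) ^ 2 / 2))
      ≤ (1 / 2) * ∑ a, ∑ c, p.b a c * (((δ a - δ c) - (δ₀ a - δ₀ c)) ^ 2 / 2) := by
  refine mul_le_mul_of_nonneg_left ?_ (by norm_num)
  have hterm : ∀ a c, 0 ≤ p.b a c * (((δ a - δ c) - (δ₀ a - δ₀ c)) ^ 2 / 2) :=
    fun a c => mul_nonneg (hb a c) (by positivity)
  calc p.b i j * (((δ i - δ j) - (δ₀ i - δ₀ j)) ^ 2 / 2)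
      ≤ ∑ c, p.b i c * (((δ i - δ c) - (δ₀ i - δ₀ c)) ^ 2 / 2) :=
        Finset.single_le_sum (f := fun c => p.b i c * (((δ i - δ c) - (δ₀ i - δ₀ c)) ^ 2 / 2))
          (fun c _ => hterm i c) (mem_univ j)
    _ ≤ ∑ a, ∑ c, p.b a c * (((δ a - δ c) - (δ₀ a - δ₀ c)) ^ 2 / 2) :=
        Finset.single_le_sum (f := fun a => ∑ c, p.b a c * (((δ a - δ c) - (δ₀ a - δ₀ c)) ^ 2 / 2))
          (fun a _ => Finset.sum_nonneg fun c _ => hterm a c) (mem_univ i)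

/-- Telescoping along a walk of the coupling graph: an edgewise bound `|φᵤ − φᵥ| ≤ ε` on adjacent
buses gives `|φᵢ − φⱼ| ≤ (length of the walk)·ε`. -/
theorem abs_sub_le_length_mul (p : Params n) {φ : Fin n → ℝ} {ε : ℝ}
    (h : ∀ u v, p.couplingGraph.Adj u v → |φ u - φ v| ≤ ε) {i j : Fin n}
    (w : p.couplingGraph.Walk i j) : |φ i - φ j| ≤ w.length * ε := by
  induction w with
  | nil => simp
  | @cons u v x hadj w' ih =>
    rw [SimpleGraph.Walk.length_cons]
    push_cast
    calc |φ u - φ x| = |(φ u - φ v) + (φ v - φ x)| := by ring_nf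
      _ ≤ |φ u - φ v| + |φ v - φ x| := abs_add_le _ _
      _ ≤ ε + w'.length * ε := add_le_add (h u v hadj) ih
      _ = (w'.length + 1) * ε := by ring

/-- In a preconnected coupling graph every two buses are joined by a PATH, of length `< n`; hence an
edgewise bound `|φᵤ − φᵥ| ≤ ε` (`ε ≥ 0`) gives `|φᵢ − φⱼ| ≤ n·ε` for all buses. -/
theorem abs_sub_le_card_mul (p : Params n) (hconn : p.couplingGraph.Preconnected)
    {φ : Fin n → ℝ} {ε : ℝ} (hε : 0 ≤ ε)
    (h : ∀ u v, p.couplingGraph.Adj u v → |φ u - φ v| ≤ ε) (i j : Fin n) :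
    |φ i - φ j| ≤ n * ε := by
  obtain ⟨w⟩ := hconn i j
  have hpath := w.bypass_isPath
  have hlen : (w.bypass.length : ℝ) ≤ n := by
    have := hpath.length_lt
    simp only [Fintype.card_fin] at this
    exact_mod_cast this.le
  calc |φ i - φ j| ≤ w.bypass.length * ε := p.abs_sub_le_length_mul h w.bypass
    _ ≤ n * ε := mul_le_mul_of_nonneg_right hlen hε

/-- **Small energy on a momentum level set confines the state** (compactness precursor for a
Lyapunov / LaSalle argument on MODEL MV-3 WITHOUT internodal coordinates). Data: well-formed,
susceptive couplings bounded below by `β > 0` on the edges of a PRECONNECTED coupling graph,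
`n ≠ 0`; window: `|δ₀ᵢ − δ₀ⱼ| ≤ θ < π/2` and `|δᵢ − δⱼ| ≤ π/2` on coupled pairs. If
`V(δ, ω) ≤ c` and `L(δ, ω) = L(δ₀, 0)` then every generator frequency satisfies
`|ωᵢ| ≤ √(2c/Mᵢ)` and every bus angle satisfies
`|δᵢ − δ₀ᵢ| ≤ (Σ_{gen} Mⱼ √(2c/Mⱼ)) / Σⱼ Dⱼ + n·√(4c/(g(θ)·β))`, `g(θ) = (1 − sin θ)/(π/2 − θ)`:
the kinetic bound, the quadratic lower bound `g(θ)·Q ≤ W` (`potential_ge_quadratic`), telescoping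
along a path of the coupling graph, and the momentum constraint pinning the D-weighted mean. -/
theorem state_bound_of_energy_le {p : Params n} (hp : p.WellFormed) (hn : n ≠ 0)
    (hconn : p.couplingGraph.Preconnected) (hb : ∀ i j, 0 ≤ p.b i j) {β : ℝ} (hβ : 0 < β)
    (hβb : ∀ i j, p.couplingGraph.Adj i j → β ≤ p.b i j)
    {δ₀ δ : Fin n → ℝ} {θ : ℝ} (hθ0 : 0 ≤ θ) (hθ : θ < π / 2)
    (h0 : ∀ i j, p.b i j ≠ 0 → |δ₀ i - δ₀ j| ≤ θ)
    (hP : ∀ i j, p.b i j ≠ 0 → |δ i - δ j| ≤ π / 2) {ω : Fin n → ℝ} {c : ℝ}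
    (hV : p.energy δ₀ δ ω ≤ c) (hL : p.momentum δ ω = p.momentum δ₀ 0) :
    (∀ i ∈ p.gen, |ω i| ≤ Real.sqrt (2 * c / p.M i)) ∧
    ∀ i, |δ i - δ₀ i| ≤ (∑ j ∈ p.gen, p.M j * Real.sqrt (2 * c / p.M j)) / (∑ j, p.D j)
        + n * Real.sqrt (4 * c / ((1 - Real.sin θ) / (π / 2 - θ) * β)) := by
  set g := (1 - Real.sin θ) / (π / 2 - θ) with hg
  have hgpos : 0 < g :=
    Literature.MathematicalPhysics.PowerSystems.SinusoidalCoupling.sectorGain_pos hθ0 hθ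
  -- nonnegativity of both parts of the energy on the window
  have hPP : ∀ i j, p.b i j ≠ 0 → |(δ i - δ j) + (δ₀ i - δ₀ j)| ≤ π := by
    intro i j hij
    have h1 := abs_le.mp (hP i j hij)
    have h2 := abs_le.mp ((h0 i j hij).trans hθ.le)
    exact abs_le.mpr ⟨by linarith [h1.1, h2.1], by linarith [h1.2, h2.2]⟩
  have hW0 : 0 ≤ p.potential δ₀ δ :=
    p.potential_nonneg hb (fun i j hij => (h0 i j hij).trans hθ.le) hPP
  have hK0 : 0 ≤ p.kinetic ω := p.kinetic_nonneg (fun i hi => (hp.M_pos i hi).le) ω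
  have hKc : p.kinetic ω ≤ c := by unfold energy at hV; linarith
  have hWc : p.potential δ₀ δ ≤ c := by unfold energy at hV; linarith
  -- (1) generator frequencies
  have hω : ∀ i ∈ p.gen, |ω i| ≤ Real.sqrt (2 * c / p.M i) := by
    intro i hi
    have hMi := hp.M_pos i hi
    have h1 := p.half_M_mul_sq_le_kinetic (fun j hj => (hp.M_pos j hj).le) ω hi
    refine Real.abs_le_sqrt ?_
    rw [le_div_iff₀ hMi]
    nlinarith
  refine ⟨hω, fun i => ?_⟩
  -- (2) branch deviations from g·Q ≤ W ≤ c
  set φ : Fin n → ℝ := fun k => δ k - δ₀ k with hφ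
  have hQ := p.potential_ge_quadratic hb hθ0 hθ h0 hP
  have hedge : ∀ u v, p.couplingGraph.Adj u v → |φ u - φ v| ≤ Real.sqrt (4 * c / (g * β)) := by
    intro u v huv
    have hbuv : β ≤ p.b u v := hβb u v huv
    have hbpos : 0 < p.b u v := lt_of_lt_of_le hβ hbuv
    have h1 := p.branch_sq_le_quadraticGap hb δ₀ δ u v
    -- g * (b_uv Δ²/4) ≤ g * Q ≤ W ≤ c
    have h2 : g * ((1 / 2) * (p.b u v * (((δ u - δ v) - (δ₀ u - δ₀ v)) ^ 2 / 2))) ≤ c :=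
      le_trans (mul_le_mul_of_nonneg_left h1 hgpos.le) (le_trans hQ hWc)
    refine Real.abs_le_sqrt ?_
    rw [le_div_iff₀ (mul_pos hgpos hβ)]
    have hid : φ u - φ v = (δ u - δ v) - (δ₀ u - δ₀ v) := by simp only [hφ]; ring
    rw [hid]
    have hsq : 0 ≤ ((δ u - δ v) - (δ₀ u - δ₀ v)) ^ 2 := sq_nonneg _
    nlinarith [mul_le_mul_of_nonneg_left hbuv (mul_nonneg hgpos.le hsq)]
  have hεnn : 0 ≤ Real.sqrt (4 * c / (g * β)) := Real.sqrt_nonneg _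
  have hpair : ∀ j, |φ i - φ j| ≤ n * Real.sqrt (4 * c / (g * β)) :=
    fun j => p.abs_sub_le_card_mul hconn hεnn hedge i j
  -- (3) the momentum constraint pins the D-weighted mean of φ
  have hDsum := sum_D_pos hp hn
  have hmom : ∑ j, p.D j * φ j = -∑ j ∈ p.gen, p.M j * ω j := by
    have : p.momentum δ ω - p.momentum δ₀ 0 = 0 := sub_eq_zero.mpr hL
    unfold momentum at this
    simp only [Pi.zero_apply, mul_zero, Finset.sum_const_zero, zero_add] at this
    have hsplit : ∑ j, p.D j * δ j - ∑ j, p.D j * δ₀ j = ∑ j, p.D j * φ j := by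
      rw [← Finset.sum_sub_distrib]
      exact Finset.sum_congr rfl fun j _ => by simp only [hφ]; ring
    linarith
  have hmeanbd : |∑ j, p.D j * φ j| ≤ ∑ j ∈ p.gen, p.M j * Real.sqrt (2 * c / p.M j) := by
    rw [hmom, abs_neg]
    refine (Finset.abs_sum_le_sum_abs _ _).trans (Finset.sum_le_sum fun j hj => ?_)
    rw [abs_mul, abs_of_pos (hp.M_pos j hj)]
    exact mul_le_mul_of_nonneg_left (hω j hj) (hp.M_pos j hj).le
  -- ΣD · φ i = Σ_j D_j φ_j + Σ_j D_j (φ i − φ j)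
  have hdecomp : (∑ j, p.D j) * φ i = ∑ j, p.D j * φ j + ∑ j, p.D j * (φ i - φ j) := by
    rw [Finset.sum_mul, ← Finset.sum_add_distrib]
    exact Finset.sum_congr rfl fun j _ => by ring
  have hdev : |∑ j, p.D j * (φ i - φ j)| ≤ (∑ j, p.D j) * (n * Real.sqrt (4 * c / (g * β))) := by
    refine (Finset.abs_sum_le_sum_abs _ _).trans ?_
    rw [Finset.sum_mul]
    refine Finset.sum_le_sum fun j _ => ?_
    rw [abs_mul, abs_of_pos (hp.D_pos j)]
    exact mul_le_mul_of_nonneg_left (hpair j) (hp.D_pos j).le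
  have habs : (∑ j, p.D j) * |φ i|
      ≤ ∑ j ∈ p.gen, p.M j * Real.sqrt (2 * c / p.M j)
        + (∑ j, p.D j) * (n * Real.sqrt (4 * c / (g * β))) := by
    rw [← abs_of_pos hDsum, ← abs_mul, abs_of_pos hDsum, hdecomp]
    exact (abs_add_le _ _).trans (add_le_add hmeanbd hdev)
  have : |φ i| ≤ (∑ j ∈ p.gen, p.M j * Real.sqrt (2 * c / p.M j)) / (∑ j, p.D j)
      + n * Real.sqrt (4 * c / (g * β)) := by
    rw [div_add' _ _ _ hDsum.ne', le_div_iff₀ hDsum]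
    linarith
  simpa only [hφ] using this

/-- **Small energy keeps every coupled branch STRICTLY inside the window** (appended by model-2
g2): with the data of `state_bound_of_energy_le` (no momentum constraint needed), if `V(δ, ω) ≤ c`
with `c < g(θ)·β·(π/2 − θ)²/4` then every coupled branch satisfies `|δᵢ − δⱼ| < π/2` — strictly.
This is the fact that lets a sublevel set `{V ≤ c} ∩ (closed window)` avoid the window's boundary,
i.e. the «isolated in the domain» / H-open hypothesis of the tree's sublevel-invariance theorems
(`Literature/Analysis/ODE/LyapunovSublevelInvariance`) for MODEL MV-3; the ODE assembly itself is
not claimed here. -/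
theorem branch_abs_lt_of_energy_le {p : Params n} (hp : p.WellFormed) (hb : ∀ i j, 0 ≤ p.b i j)
    {β : ℝ} (hβ : 0 < β) (hβb : ∀ i j, p.couplingGraph.Adj i j → β ≤ p.b i j)
    {δ₀ δ : Fin n → ℝ} {θ : ℝ} (hθ0 : 0 ≤ θ) (hθ : θ < π / 2)
    (h0 : ∀ i j, p.b i j ≠ 0 → |δ₀ i - δ₀ j| ≤ θ)
    (hP : ∀ i j, p.b i j ≠ 0 → |δ i - δ j| ≤ π / 2) {ω : Fin n → ℝ} {c : ℝ}
    (hV : p.energy δ₀ δ ω ≤ c)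
    (hc : c < (1 - Real.sin θ) / (π / 2 - θ) * β * (π / 2 - θ) ^ 2 / 4) :
    ∀ i j, p.b i j ≠ 0 → |δ i - δ j| < π / 2 := by
  set g := (1 - Real.sin θ) / (π / 2 - θ) with hg
  have hgpos : 0 < g :=
    Literature.MathematicalPhysics.PowerSystems.SinusoidalCoupling.sectorGain_pos hθ0 hθ
  have hK0 : 0 ≤ p.kinetic ω := p.kinetic_nonneg (fun i hi => (hp.M_pos i hi).le) ω
  have hWc : p.potential δ₀ δ ≤ c := by unfold energy at hV; linarith
  have hQ := p.potential_ge_quadratic hb hθ0 hθ h0 hP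
  intro i j hij
  by_cases hdiag : i = j
  · subst hdiag
    simp only [sub_self, abs_zero]
    linarith [Real.pi_pos]
  · have hadj : p.couplingGraph.Adj i j :=
      (p.couplingGraph_adj_of_symm hp.b_symm i j).mpr ⟨hdiag, hij⟩
    have hbij : β ≤ p.b i j := hβb i j hadj
    have h1 := p.branch_sq_le_quadraticGap hb δ₀ δ i j
    -- g·β·Δ²/4 ≤ g·b_ij·Δ²/4 ≤ g·Q ≤ W ≤ c < g·β·(π/2 − θ)²/4
    set Δ := (δ i - δ j) - (δ₀ i - δ₀ j) with hΔ
    have hsq : 0 ≤ Δ ^ 2 := sq_nonneg _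
    have h2 : g * ((1 / 2) * (p.b i j * (Δ ^ 2 / 2))) ≤ c :=
      le_trans (mul_le_mul_of_nonneg_left h1 hgpos.le) (le_trans hQ hWc)
    have h3 : g * β * Δ ^ 2 / 4 ≤ c := by
      have := mul_le_mul_of_nonneg_left hbij (mul_nonneg hgpos.le hsq)
      nlinarith
    have h4 : Δ ^ 2 < (π / 2 - θ) ^ 2 := by
      have hgb : 0 < g * β := mul_pos hgpos hβ
      nlinarith
    have h5 : |Δ| < π / 2 - θ :=
      abs_lt.mpr (abs_lt_of_sq_lt_sq' h4 (by linarith))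
    have h6 := abs_le.mp (h0 i j hij)
    have h7 := abs_lt.mp h5
    refine abs_lt.mpr ⟨?_, ?_⟩
    · have : δ i - δ j = Δ + (δ₀ i - δ₀ j) := by rw [hΔ]; ring
      rw [this]; linarith [h6.1, h7.1]
    · have : δ i - δ j = Δ + (δ₀ i - δ₀ j) := by rw [hΔ]; ring
      rw [this]; linarith [h6.2, h7.2]

end Summit.Ventures.GridStability.Models.StructurePreserving.Params

end
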